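import Literature.NumberTheory.Rogawski1990.ArchTransfFamily                -- ★ p849747 (LH7-p02 (g2)): `transfFam`, `transfFamReg`, `bzExtendG` (+ transport principle), `slotPerm`, `partnerPerms`
import Literature.NumberTheory.Rogawski1990.ArchBouazizStableFamily        -- ★ p849717 (LH3-p01 (g3)): `endoTorus_add_angleShift` (+ ★ `ArchBouazizSpace(H)`: `ArchBzPeriodic`, `ArchBzCompactSupport`)
import Literature.NumberTheory.Rogawski1990.ArchHCSpaceG                  -- ★ p849664 (LH3-p02 (g2)): `ArchHcPeriodic`, `ArchHcCompactSupport`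
import Mathlib.Topology.Perfect
import HarnessLib

/-!
# (P) and (I₄) for the candidate transfer family `transfFam`: periodicity in the angle slots and compact support modulo conjugacy — two of the five conjuncts of
# organ O-L2 «Transf» as unconditional theorems, with the `G′`-chart periodicity kit and the density of the `G`-regular set they rest on
# (Rogawski 1990 §4.3 (4.3.1) p. 43, §3.6 p. 31; Bouaziz 1994 §3.1 p. 579, Rem. 2 p. 594; Shelstad 1979 §4 p. 22)

Topic `NumberTheory/Rogawski1990`; namespace `Literature.NumberTheory.Rogawski1990`.  THEOREMS ONLY (no definition, no instance, no notation, no axiom, no named fact, no `sorry`).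
Cell `pub/hodgecm-mathlib`, line LH3 (closer stub `stub_N9` — archimedean endoscopic transfer — of `Cruxes/H413/Lines/F0_U3LettersRung1.lean`, crux H413 = `stmt-HodgeConjecture-24833`):
organ **(L2-PWC)**, ED. 1 (LH3-plan (g2) DEAL 2026-09-02T06:14:34Z; author LH7-p02 (g2)): of the five conjuncts of `ArchBouazizSpaceH jcH (transfFam L α μ F)` that the load-bearing
organ O-L2 asserts for a Harish-Chandra family `F` on the `G′`-charts, the two ELEMENTARY ones — (P) periodicity and (I₄) compact support — proved here for every `F` with the
corresponding `G′`-side clause; (W) is ED. 2 (it needs `Δ″` constant on STABLE classes of `γ_H` and the realised split reflection on `gprimeTorus`, stated there with what is not ★ as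
hypotheses); (I₁)+(I₂) (smooth gluing across the `G`-walls) and (I₃) (the jumps) ARE the organ.

* §1 THE `G′`-CHART PERIODICITY KIT (one owner; also what `orbFamG`'s (P) needs): `circleExp_angleShift_eq_one`, `gprimeCptGL_eq_one_of_circleExp_eq_one`,
  `gprimeSplitGL_eq_one_of`, **`gprimeTorus_angleShift_eq_one`** (the angle lattice lies in the kernel of the group law ★ `gprimeTorus_add`), **`gprimeTorus_add_angleShift`**,
  `cexp_add_angleShift_mul_I`, **`archRG_add_angleShift`**, `add_angleShift_mem_regG_iff`, `slotPerm_add_angleShift` — all under the angle-slot guard `w ∉ S′ ∨ i ≠ 0`.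
* §2 **`dense_regG : Dense (RegG S)`** — the `G`-regular set is dense in the coordinate space (its complement is a finite union of codimension-one walls; proof along the line
  `c + t • v` with slopes `v w i = i + 1`: the bad parameters are countable, Mathlib `Set.Countable.dense_compl`).  Needed because ★ `bzExtendG` reads `RegG`-LIMITS on
  `InRegS ∖ RegG`, which are junk-free exactly on `closure (RegG S) = univ`; (M2)∕(GLUE) will use it the same way.
* §3 (P) **`archBzPeriodic_transfFam (hF : ArchHcPeriodic F) : ArchBzPeriodic (transfFam L α μ F)`** — the partner sum is periodic in every angle slot of the `H`-chart (★
  `archRH_add_angleShift`, ★ `endoTorus_add_angleShift`, §1 for the partner points `slotPerm ρ c` — the shifted slot moves to `(ρ w)⁻¹ i`, still an angle slot — and `hF`), and the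
  wall extension is transported by the homeomorphism `· + 2πk e_{(w,i)}` (★ `bzExtendG_apply_homeomorph`).
* §4 (I₄) **`archBzCompactSupport_transfFam (hF : ArchHcCompactSupport F) : ArchBzCompactSupport (transfFam L α μ F)`** with the SAME bound `Rb` as `F` on the same label: the
  partner permutations fix the split slots (`slotPerm_apply_of_mem`), so the partner sum vanishes on the OPEN set `{∃ w ∈ S, Rb < |x_w|}`; on `RegG` literally, on `InRegS ∖ RegG`
  as the `RegG`-limit of an eventually-zero function (§2), off `InRegS` by definition.
HONEST LABEL: HC_CM is proved only modulo the 7 printed citations (2 remaining: hLiu418 = stmt-HodgeConjecture-24832, h413 = stmt-HodgeConjecture-24833) until rung 0 closes; count-neutral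
(support theorems the O-L2 prover invokes by name).

## References
* [Rogawski1990] J. D. Rogawski, *Automorphic Representations of Unitary Groups in Three Variables*, Ann. of Math. Stud. 123 (1990), §4.3 (4.3.1) p. 43, §3.6 p. 31, §8.2 p. 122.
* [Bouaziz1994IntegralesOrbitales] A. Bouaziz, *Intégrales orbitales sur les groupes de Lie réductifs*, Ann. Sci. ÉNS 27 (1994), §3.1 p. 579 ((I₁)–(I₄)), Rem. 2 p. 594.
* [Shelstad1979] D. Shelstad, *Characters and inner forms of a quasi-split group over ℝ*, Compositio Math. 39 (1979), §4 p. 22, Lemma 4.2 p. 23.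
* [Knapp1986] A. W. Knapp, *Representation Theory of Semisimple Groups* (1986), Ch. V §3 (Cartan subgroups of `U(2,1)`).
-/

set_option autoImplicit false

noncomputable section

open NumberField NumberField.InfinitePlace Matrix Complex Set Filter Topology
open scoped MatrixGroups Matrix Classical Real
open Literature.NumberTheory.Automorphic Literature.NumberTheory.Automorphic.UnitaryGroup Literature.NumberTheory.Automorphic.ArchCartan
open Literature.NumberTheory.GaloisRepresentations

namespace Literature.NumberTheory.Rogawski1990

/-! ## §1 The `G′`-chart periodicity kit -/

section Kit

variable {W : Type*} [DecidableEq W]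

/-- Every `2πℤ`-shift coordinate has trivial circle exponential: `e^{i·(angleShift w i k) v j} = 1`. [cite: Shelstad1979, §4 p. 22] -/
theorem circleExp_angleShift_eq_one (w : W) (i : Fin 3) (k : ℤ) (v : W) (j : Fin 3) : Circle.exp (angleShift w i k v j) = 1 := by
  by_cases hv : v = w
  · subst hv
    by_cases hj : j = i
    · subst hj
      rw [angleShift_apply_self, Circle.exp_two_pi_mul_int]
    · rw [angleShift_apply_self_of_ne v hj, Circle.exp_zero]
  · rw [angleShift_apply_of_ne hv, Pi.zero_apply, Circle.exp_zero]

/-- `cexp (i·(c + angleShift) w′ j) = cexp (i·c w′ j)` — the `ℂ`-valued reading of ★ `circleExp_add_angleShift`. [cite: Shelstad1979, §4 p. 22] -/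
theorem cexp_add_angleShift_mul_I (c : W → Fin 3 → ℝ) (w : W) (i : Fin 3) (k : ℤ) (w' : W) (j : Fin 3) :
    Complex.exp ((((c + angleShift w i k) w' j : ℝ) : ℂ) * I) = Complex.exp (((c w' j : ℝ) : ℂ) * I) := by
  rw [← Circle.coe_exp, ← Circle.coe_exp, circleExp_add_angleShift]

/-- An ANGULAR shift does not touch the split slot `0` of a split place: `(c + angleShift w i k) v 0 = c v 0` whenever `v ≠ w` or `i ≠ 0`. [cite: Shelstad1979, §4 p. 22] -/
theorem add_angleShift_apply_zero {w : W} {i : Fin 3} {v : W} (h : v ≠ w ∨ i ≠ 0) (c : W → Fin 3 → ℝ) (k : ℤ) : (c + angleShift w i k) v 0 = c v 0 := by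
  rw [Pi.add_apply, Pi.add_apply]
  rcases h with hv | hi
  · rw [angleShift_apply_of_ne hv, Pi.zero_apply, add_zero]
  · by_cases hv : v = w
    · subst hv; rw [angleShift_apply_self_of_ne v hi.symm, add_zero]
    · rw [angleShift_apply_of_ne hv, Pi.zero_apply, add_zero]

/-- **The compact place chart is `1` at a point all of whose angles are in `2πℤ`.** [cite: Rogawski1990, §3.6 p. 31] -/
theorem gprimeCptGL_eq_one_of_circleExp_eq_one (τ : Fin 3 ≃ Fin 3) {d : Fin 3 → ℝ} (h : ∀ j, Circle.exp (d j) = 1) : gprimeCptGL τ d = 1 := by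
  unfold gprimeCptGL
  have h1 : (fun ℓ => Circle.exp (d (τ.symm ℓ))) = 1 := funext fun ℓ => h _
  rw [h1, map_one]

/-- **The split place chart is `1` at a point with `x = 0` and angles in `2πℤ`** (★ `gprimeSplitMatrix_zero`: the `x = 0` edge of the split chart is the compact chart).
[cite: Knapp1986, Ch. V §3] [cite: Rogawski1990, §3.6 p. 31] -/
theorem gprimeSplitGL_eq_one_of (τ : Fin 3 ≃ Fin 3) (a : Fin 3 → ℝ) {d : Fin 3 → ℝ} (h0 : d 0 = 0) (h1 : Circle.exp (d 1) = 1) (h2 : Circle.exp (d 2) = 1) :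
    gprimeSplitGL τ a d = 1 := by
  have hd : d = ![0, d 1, d 2] := by
    funext j; fin_cases j
    · exact h0
    · rfl
    · rfl
  refine Units.ext ?_
  rw [coe_gprimeSplitGL, hd, gprimeSplitMatrix_zero, Units.val_one]
  have h' : gprimeCptGL τ ![d 2, d 1, d 2] = 1 := gprimeCptGL_eq_one_of_circleExp_eq_one τ fun j => by
    fin_cases j
    · exact h2
    · exact h1
    · exact h2
  rw [h', Units.val_one]

end Kit

section KitCM

variable (L : Type) [Field L] [NumberField L] [IsCMField L] (α : Fin 3 → L)

/-- **THE ANGLE LATTICE LIES IN THE KERNEL OF THE `G′`-CHART**: `gprimeTorus L α S′ (angleShift w i k) = 1` for every angle slot `(w, i)` of the chart `S′` (`w ∉ S′ ∨ i ≠ 0`) —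
place by place the block is the compact chart at angles in `2πℤ`, or the split chart at `x = 0` and angles in `2πℤ`. [cite: Rogawski1990, §3.6 p. 31] [cite: Knapp1986, Ch. V §3] -/
theorem gprimeTorus_angleShift_eq_one (S' : Finset {w : InfinitePlace L // IsComplex w}) {w : {w : InfinitePlace L // IsComplex w}} {i : Fin 3}
    (h : w ∉ S' ∨ i ≠ 0) (k : ℤ) : gprimeTorus L α S' (angleShift w i k) = 1 := by
  unfold gprimeTorus
  have hb : (fun v => gprimeBlock L α v S' (angleShift w i k)) = 1 := by
    funext v
    apply Subtype.ext
    rw [Pi.one_apply, Subgroup.coe_one]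
    by_cases hv : v ∈ S' ∧ v ∈ splitChartPlaces L α
    · rw [coe_gprimeBlock_of_mem L α _ hv.1 hv.2]
      have hv0 : v ≠ w ∨ i ≠ 0 := by
        by_cases hvw : v = w
        · subst hvw
          rcases h with hw | hi
          · exact absurd hv.1 hw
          · exact Or.inr hi
        · exact Or.inl hvw
      have h0 : angleShift w i k v 0 = 0 := by
        have := add_angleShift_apply_zero hv0 (0 : {w : InfinitePlace L // IsComplex w} → Fin 3 → ℝ) k
        rwa [zero_add, Pi.zero_apply, Pi.zero_apply] at this
      exact gprimeSplitGL_eq_one_of _ _ h0 (circleExp_angleShift_eq_one w i k v 1) (circleExp_angleShift_eq_one w i k v 2)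
    · unfold gprimeBlock
      rw [dif_neg hv]
      exact gprimeCptGL_eq_one_of_circleExp_eq_one _ fun j => circleExp_angleShift_eq_one w i k v j
  rw [hb, map_one]

/-- **THE `G′`-CHART IS `2π`-PERIODIC IN ITS ANGLE SLOTS**: `gprimeTorus L α S′ (c + angleShift w i k) = gprimeTorus L α S′ c` (`w ∉ S′ ∨ i ≠ 0`) — the group law ★ `gprimeTorus_add`
and the kernel lemma. [cite: Rogawski1990, §3.6 p. 31] [cite: Shelstad1979, §4 p. 22] -/
theorem gprimeTorus_add_angleShift (S' : Finset {w : InfinitePlace L // IsComplex w}) (c : {w : InfinitePlace L // IsComplex w} → Fin 3 → ℝ)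
    {w : {w : InfinitePlace L // IsComplex w}} {i : Fin 3} (h : w ∉ S' ∨ i ≠ 0) (k : ℤ) :
    gprimeTorus L α S' (c + angleShift w i k) = gprimeTorus L α S' c := by
  rw [gprimeTorus_add, gprimeTorus_angleShift_eq_one L α S' h k, mul_one]

end KitCM

section KitRG

variable {W : Type*} [Fintype W] [DecidableEq W]

/-- **SHELSTAD'S `R′` ON THE `G′`-CHART IS `2π`-PERIODIC IN THE ANGLE SLOTS**: `archRG S′ (c + angleShift w i k) = archRG S′ c` (`w ∉ S′ ∨ i ≠ 0`) — every factor reads the angles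
through `e^{iθ}` and the split slot `x` is not moved. [cite: Shelstad1979, §4 p. 22] [cite: Rogawski1990, §8.2 p. 118] -/
theorem archRG_add_angleShift (S' : Finset W) (c : W → Fin 3 → ℝ) {w : W} {i : Fin 3} (h : w ∉ S' ∨ i ≠ 0) (k : ℤ) :
    archRG S' (c + angleShift w i k) = archRG S' c := by
  unfold archRG
  refine Finset.prod_congr rfl fun v _ => ?_
  by_cases hS : v ∈ S'
  · have hv0 : v ≠ w ∨ i ≠ 0 := by
      by_cases hvw : v = w
      · subst hvw
        rcases h with hw | hi
        · exact absurd hS hw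
        · exact Or.inr hi
      · exact Or.inl hvw
    rw [if_pos hS, if_pos hS]
    simp only [Complex.exp_add, cexp_add_angleShift_mul_I, add_angleShift_apply_zero hv0]
  · rw [if_neg hS, if_neg hS]
    simp only [Circle.exp_sub, circleExp_add_angleShift]

omit [Fintype W] in
/-- **`RegG S′` is invariant under the angular shifts** (`w ∉ S′ ∨ i ≠ 0`): injectivity of `i ↦ e^{i c w i}` reads angles only, the split slot is not moved.
[cite: Bouaziz1994IntegralesOrbitales, §3.1 p. 579] [cite: Shelstad1979, §4 p. 22] -/
theorem add_angleShift_mem_regG_iff (S' : Finset W) (c : W → Fin 3 → ℝ) {w : W} {i : Fin 3} (h : w ∉ S' ∨ i ≠ 0) (k : ℤ) :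
    c + angleShift w i k ∈ RegG S' ↔ c ∈ RegG S' := by
  rw [mem_regG_iff, mem_regG_iff]
  refine and_congr (forall_congr' fun v => forall_congr' fun _ => ?_) (forall_congr' fun v => forall_congr' fun hv => ?_)
  · simp only [circleExp_add_angleShift]
  · have hv0 : v ≠ w ∨ i ≠ 0 := by
      by_cases hvw : v = w
      · subst hvw
        rcases h with hw | hi
        · exact absurd hv hw
        · exact Or.inr hi
      · exact Or.inl hvw
    rw [add_angleShift_apply_zero hv0]

omit [Fintype W] in
/-- **Slot re-labelling moves the shifted slot**: `slotPerm ρ (c + angleShift w i k) = slotPerm ρ c + angleShift w ((ρ w)⁻¹ i) k`. [cite: Shelstad1979, Lemma 4.2 (p. 23)] -/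
theorem slotPerm_add_angleShift (ρ : W → Equiv.Perm (Fin 3)) (c : W → Fin 3 → ℝ) (w : W) (i : Fin 3) (k : ℤ) :
    slotPerm ρ (c + angleShift w i k) = slotPerm ρ c + angleShift w ((ρ w).symm i) k := by
  funext v j
  simp only [slotPerm_apply, Pi.add_apply]
  congr 1
  by_cases hv : v = w
  · subst hv
    by_cases hj : ρ v j = i
    · have hs : (ρ v).symm i = j := by rw [← hj, Equiv.symm_apply_apply]
      rw [hj, hs, angleShift_apply_self, angleShift_apply_self]
    · have hj' : j ≠ (ρ v).symm i := fun e => hj (by rw [e, Equiv.apply_symm_apply])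
      rw [angleShift_apply_self_of_ne v hj, angleShift_apply_self_of_ne v hj']
  · simp only [angleShift_apply_of_ne hv, Pi.zero_apply]

/-- A partner permutation sends an angle slot of the `H`-chart to an angle slot: `w ∉ S ∨ (ρ w)⁻¹ i ≠ 0` from `w ∉ S ∨ i ≠ 0` (at a split place `ρ w = 1`).
[cite: Shelstad1979, Lemma 4.2 (p. 23)] -/
theorem angleSlot_slotPerm {S : Finset W} {ρ : W → Equiv.Perm (Fin 3)} (hρ : ρ ∈ partnerPerms S) {w : W} {i : Fin 3} (h : w ∉ S ∨ i ≠ 0) :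
    w ∉ S ∨ (ρ w).symm i ≠ 0 := by
  by_cases hw : w ∈ S
  · right
    rcases h with hw' | hi
    · exact absurd hw hw'
    · rw [eq_one_of_mem_partnerPerms hρ hw]
      exact hi
  · exact Or.inl hw

end KitRG

/-! ## §2 The `G`-regular set is dense -/

section Dense

variable {W : Type*} [Fintype W] [DecidableEq W]

omit [DecidableEq W] in
/-- **`RegG S` IS DENSE** in the coordinate space `W → Fin 3 → ℝ`: its complement is a finite union of codimension-one walls (`e^{i c w i} = e^{i c w j}` at a compact place, `x_w = 0`
at a split place).  Proof along the line `t ↦ c + t • v`, `v w i = i + 1`: the parameters `t` for which `c + t • v ∉ RegG S` form a COUNTABLE set (one value per split place, an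
arithmetic progression per compact place and pair of slots), whose complement is dense in `ℝ` (Mathlib `Set.Countable.dense_compl`). [cite: Bouaziz1994IntegralesOrbitales, §3.1 p. 579] -/
theorem dense_regG (S : Finset W) : Dense (RegG S) := by
  intro c
  -- the line and its slopes
  let v : W → Fin 3 → ℝ := fun _ j => ((j : ℕ) : ℝ) + 1
  let f : ℝ → (W → Fin 3 → ℝ) := fun t => c + t • v
  have hfc : Continuous f := continuous_const.add (continuous_id.smul continuous_const)
  have hft : ∀ t w' j, f t w' j = c w' j + t * (((j : ℕ) : ℝ) + 1) := fun t w' j => by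
    simp only [f, v, Pi.add_apply, Pi.smul_apply, smul_eq_mul]
  -- the bad parameters
  obtain ⟨B, hB⟩ : ∃ B : Set ℝ, B = (⋃ w ∈ S, {-(c w 0)}) ∪
      ⋃ (w : W) (i : Fin 3) (j : Fin 3), Set.range (fun m : ℤ => ((m : ℝ) * (2 * π) - (c w i - c w j)) / ((((i : ℕ) : ℝ)) - ((j : ℕ) : ℝ))) := ⟨_, rfl⟩
  have hBc : B.Countable := by
    rw [hB]
    refine Set.Countable.union ?_ ?_
    · exact Set.countable_iUnion fun w => Set.countable_iUnion fun _ => Set.countable_singleton _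
    · exact Set.countable_iUnion fun w => Set.countable_iUnion fun i => Set.countable_iUnion fun j => Set.countable_range _
  -- good parameters give `G`-regular points
  have hgood : ∀ t, t ∉ B → f t ∈ RegG S := by
    intro t ht
    rw [hB] at ht
    simp only [Set.mem_union, Set.mem_iUnion, Set.mem_singleton_iff, Set.mem_range, not_or, not_exists] at ht
    refine (mem_regG_iff S (f t)).2 ⟨fun w _ => ?_, fun w hw => ?_⟩
    · intro i j hij
      by_contra hne
      have hij' := Circle.exp_eq_exp.1 hij
      obtain ⟨m, hm⟩ := hij'
      rw [hft, hft] at hm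
      have hden : (((i : ℕ) : ℝ)) - ((j : ℕ) : ℝ) ≠ 0 := by
        intro h0
        exact hne (Fin.ext (Nat.cast_injective (R := ℝ) (sub_eq_zero.1 h0)))
      apply ht.2 w i j m
      field_simp
      linarith
    · rw [hft]
      simp only [Fin.val_zero, Nat.cast_zero, zero_add, mul_one]
      intro h0
      exact ht.1 w hw (by linarith)
  -- density of the good parameters, pushed along the line
  have h0 : (0 : ℝ) ∈ closure Bᶜ := by
    rw [(Set.Countable.dense_compl ℝ hBc).closure_eq]
    exact Set.mem_univ _
  have himg : f 0 ∈ closure (f '' Bᶜ) := image_closure_subset_closure_image hfc ⟨0, h0, rfl⟩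
  have hsub : f '' Bᶜ ⊆ RegG S := by
    rintro _ ⟨t, ht, rfl⟩
    exact hgood t ht
  have hc0 : f 0 = c := by simp [f]
  rw [← hc0]
  exact closure_mono hsub himg

omit [DecidableEq W] in
/-- Every point of the coordinate space is in the closure of `RegG S`; in particular the filter `𝓝[RegG S] c` is non-trivial. [cite: Bouaziz1994IntegralesOrbitales, §3.1 p. 579] -/
theorem mem_closure_regG (S : Finset W) (c : W → Fin 3 → ℝ) : c ∈ closure (RegG S) :=
  dense_regG S c

end Dense

/-! ## §3 (P): the candidate transfer family is periodic in the angle slots -/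

section Symmetries

variable (L : Type) [Field L] [NumberField L] [IsCMField L] (α : Fin 3 → L) (μ : HeckeCharacter L)
  (F : Finset {w : InfinitePlace L // IsComplex w} → ({w : InfinitePlace L // IsComplex w} → Fin 3 → ℝ) → ℂ)

/-- **The partner sum is `2π`-periodic in every angle slot of the `H`-chart** (for every `c`, not only regular ones): `R_S` (★ `archRH_add_angleShift`), the chart point `endoTorus`
(★ `endoTorus_add_angleShift`), the partner points `gprimeTorus S (ρ·c)` and their `R′` (§1 — the shifted slot moves to `(ρ w)⁻¹ i`), and `F S` (`hF`) are all unchanged.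
[cite: Shelstad1979, §4 p. 22] [cite: Rogawski1990, §4.3 (4.3.1) p. 43] -/
theorem transfFamReg_add_angleShift (hF : ArchHcPeriodic F) (S : Finset {w : InfinitePlace L // IsComplex w}) (c : {w : InfinitePlace L // IsComplex w} → Fin 3 → ℝ)
    {w : {w : InfinitePlace L // IsComplex w}} {i : Fin 3} (h : w ∉ S ∨ i ≠ 0) (k : ℤ) :
    transfFamReg L α μ F S (c + angleShift w i k) = transfFamReg L α μ F S c := by
  unfold transfFamReg
  rw [archRH_add_angleShift S c h k]
  refine congrArg (fun s => archRH S c * partnerWeight L α S * s) (Finset.sum_congr rfl fun ρ hρ => ?_)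
  have hρw : w ∉ S ∨ (ρ w).symm i ≠ 0 := angleSlot_slotPerm hρ h
  rw [endoTorus_add_angleShift L S c h k, slotPerm_add_angleShift ρ c w i k, gprimeTorus_add_angleShift L α S (slotPerm ρ c) hρw k,
    archRG_add_angleShift S (slotPerm ρ c) hρw k, hF S (slotPerm ρ c) w ((ρ w).symm i) k hρw]

/-- **(P) FOR THE CANDIDATE TRANSFER FAMILY**: `ArchBzPeriodic (transfFam L α μ F)` for every `G′`-family `F` satisfying (P) (★ `ArchHcPeriodic`) — the partner sum is periodic
(`transfFamReg_add_angleShift`) and the wall extension ★ `bzExtendG` is transported by the homeomorphism `· + 2πk e_{(w,i)}` (★ `bzExtendG_apply_homeomorph`; `RegG`, `InRegS` are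
shift-invariant). [cite: Shelstad1979, §4 p. 22] [cite: Bouaziz1994IntegralesOrbitales, §3.1 p. 579] -/
theorem archBzPeriodic_transfFam (hF : ArchHcPeriodic F) : ArchBzPeriodic (transfFam L α μ F) := by
  intro S c w i k h
  exact bzExtendG_apply_homeomorph S (transfFamReg L α μ F S) (Homeomorph.addRight (angleShift w i k))
    (fun x => add_angleShift_mem_regG_iff S x h k) (fun x => add_angleShift_mem_inRegS_iff S x w i k)
    (fun a _ => transfFamReg_add_angleShift L α μ F hF S a h k) c

/-! ## §4 (I₄): compact support modulo conjugacy -/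

/-- **The partner sum vanishes as soon as a split coordinate exceeds the support bound of `F` on the same chart** (for every `c`): the partner permutations fix the split slots
(`slotPerm_apply_of_mem`), so every term reads `F S` at a point with the same `x_w`. [cite: Bouaziz1994IntegralesOrbitales, §3.1 p. 579] -/
theorem transfFamReg_eq_zero_of_lt_abs (S : Finset {w : InfinitePlace L // IsComplex w}) {Rb : ℝ}
    (hRb : ∀ c : {w : InfinitePlace L // IsComplex w} → Fin 3 → ℝ, (∃ w ∈ S, Rb < |c w 0|) → F S c = 0)
    {c : {w : InfinitePlace L // IsComplex w} → Fin 3 → ℝ} (hc : ∃ w ∈ S, Rb < |c w 0|) : transfFamReg L α μ F S c = 0 := by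
  unfold transfFamReg
  rw [Finset.sum_eq_zero fun ρ hρ => ?_, mul_zero]
  obtain ⟨w, hw, hlt⟩ := hc
  rw [hRb (slotPerm ρ c) ⟨w, hw, by rwa [slotPerm_apply_of_mem hρ hw]⟩, zero_div, mul_zero]

/-- **(I₄) FOR THE CANDIDATE TRANSFER FAMILY**: `ArchBzCompactSupport (transfFam L α μ F)` for every `G′`-family `F` satisfying (I₄) (★ `ArchHcCompactSupport`), with the SAME bound on
the same label: on `RegG S` literally (`transfFamReg_eq_zero_of_lt_abs`); on `InRegS S ∖ RegG S` the value is the `RegG`-limit of a function vanishing on the open neighbourhood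
`{Rb < |x_w|}`, hence `0` (Mathlib `extendFrom_eq`; the filter is non-trivial by `dense_regG`); off `InRegS S` it is `0` by definition.
[cite: Bouaziz1994IntegralesOrbitales, §3.1 p. 579] [cite: Rogawski1990, §4.3 (4.3.1) p. 43] -/
theorem archBzCompactSupport_transfFam (hF : ArchHcCompactSupport F) : ArchBzCompactSupport (transfFam L α μ F) := by
  intro S
  obtain ⟨Rb, hRb⟩ := hF S
  refine ⟨Rb, fun c hc => ?_⟩
  by_cases hcr : c ∈ RegG S
  · rw [transfFam_of_mem_regG L α μ F S hcr]
    exact transfFamReg_eq_zero_of_lt_abs L α μ F S hRb hc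
  · by_cases hci : c ∈ InRegS S
    · rw [transfFam_of_mem_inRegS_of_not_mem_regG L α μ F S hci hcr]
      obtain ⟨w, hw, hlt⟩ := hc
      -- the vanishing is an OPEN condition around `c`
      have hopen : IsOpen {c' : {w : InfinitePlace L // IsComplex w} → Fin 3 → ℝ | Rb < |c' w 0|} :=
        isOpen_lt continuous_const (((continuous_apply 0).comp (continuous_apply w)).abs)
      have hev : ∀ᶠ c' in 𝓝[RegG S] c, (0 : ℂ) = transfFamReg L α μ F S c' :=
        mem_nhdsWithin_of_mem_nhds (Filter.mem_of_superset (hopen.mem_nhds hlt) fun c' hc' => (transfFamReg_eq_zero_of_lt_abs L α μ F S hRb ⟨w, hw, hc'⟩).symm)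
      exact extendFrom_eq (mem_closure_regG S c) (tendsto_const_nhds.congr' hev)
    · exact transfFam_of_not_mem_inRegS L α μ F S hci

end Symmetries

end Literature.NumberTheory.Rogawski1990

end
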